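import Summits.Ventures.CertifiedManyBodySolver.Downfold.EmeryOrbitalWeightFaceDirBox
import Summits.Ventures.CertifiedManyBodySolver.Downfold.EmeryVanHoveSubBox
import Summits.Ventures.CertifiedManyBodySolver.Downfold.EmeryVanHoveTableB
import Summits.Ventures.CertifiedManyBodySolver.Downfold.EmeryVanHoveTableE
import Summits.Ventures.CertifiedManyBodySolver.Downfold.EmeryVanHoveTableF
import Summits.Ventures.CertifiedManyBodySolver.Downfold.EmeryFermiFaceDirPointsBi2201M61NH1176S1
import Summits.Ventures.CertifiedManyBodySolver.Downfold.EmeryFermiFaceDirPointsBi2201M61NH1176S2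
import Summits.Ventures.CertifiedManyBodySolver.Downfold.EmeryFermiFaceDirPointsBi2201M61NH1176S3
import HarnessLib

/-!
# THE ANTINODAL FERMI-SURFACE Cu-d WEIGHT OVER THE TYPED 3BE BOX `emeryBoxBi2201M61MoreePPSrc (EmeryBoxesKSlicesN)` AT FILLING n_H = 1.176 (ν = 103/250), regime-free rule v2 — the kinematic leg of the UPPER member
# `U_B∣full(w_antinode)` of the weak band-level `U` bracket read over a box where the v1 rule's antinodal charge-transfer regime FAILS at the low-Δ corners
# (INFL-3to1-B §B.90 (j); kernel `EmeryOrbitalWeightFaceDirBox`; router/EMERY-FS-WEIGHT-BRACKETS.tsv / OBJECT-E-BUDGET.tsv §C)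

Venture CertifiedManyBodySolver, cell `pub/hubbard-downfold` (stage S1), seat hubbard-downfold-mod-4 (technique B, g39); namespace
`Summit.Ventures.CertifiedManyBodySolver.Downfold.Emery`. Everything PROVED (0 sorry). WHAT THIS IS NOT: a statement about the material — the typed box (Bi₂Sr₂CuO₆₊δ (M61; Morée PP source box))
is SCREENING-GRADE; `U = 0` one-body kinematics of the σ model; the `U_B` arithmetic that consumes the window is DERIVED context on the MEAN-FIELD annex (R-B17).

For every member θ = (Δ, t_pd, t_pp, t_pp′) ∈ [1.76, 2.36] × [1.25, 1.47] × [0.62, 0.74] × [0.14, 0.17] eV at filling ν = 103/250, the Cu-d weight of the ANTINODAL Bloch state,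
`dWeightFace θ (fermiEnergyOf θ ν)`, lies in the window below. DEVICE (v2): `W(θ) = W(Δ/t_pd, 1, t_pp/t_pd, t_pp′/t_pd)` (scaling law); the t_pd range is cut into 3 slabs; on each
normalised slab the v2 CORNER RULE `dWeightFace_fermiEnergyOf_mem_Icc_of_mem_box3_dir_num`: Δ ↑ at fixed filling WITHOUT the regime (region-wide directional certificate
`faceDir_nonneg_of_mem_region`, κ₀ = 1/10, + the Fermi-energy slope law κ = 1/10 + mean value theorem), t_pp ↓, t_pp′ ↑ only at the upper corner (regime margin R2 there),
lower end `t_pp′`-decoupled (`dWeightFaceLoDec` at `E_h`); hole-likeness from the slab's `vhBoxCheck` + the Ψ table; two K = 384 Fermi-energy brackets per slab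
(`EmeryFermiFaceDirPointsBi2201M61NH1176S<k>`). The slab corners are VIRTUAL (not members): the window is a sound ENCLOSURE (lower end ≈ 0.02 below the v1 virtual-corner value).

| t_pd slab (eV) | normalised slab Δ/t_pd × t_pp/t_pd × t_pp′/t_pd | q₁ (vhBoxCheck) ≥ table point | E_h | E_v | margins (R2, 1 − κ − w̄_axis) | **w_face window** |
|---|---|---|---|---|---|---|
| [1.25, 1.323] | [1.33, 1.888] × [0.4685, 0.592] × [0.1058, 0.136] | 0.5200 ≥ 13/25 (Ψ ≤ 0.3906) | 1.3912 | 1.1508 | +0.621, +0.141 | **[0.6622, 0.7522]** |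
| [1.323, 1.397] | [1.26, 1.783] × [0.4439, 0.5592] × [0.1002, 0.1285] | 0.5006 ≥ 1/2 (Ψ ≤ 0.3931) | 1.4117 | 1.182 | +0.676, +0.152 | **[0.6563, 0.7421]** |
| [1.397, 1.47] | [1.197, 1.69] × [0.4218, 0.5298] × [0.09524, 0.1217] | 0.4823 ≥ 93/200 (Ψ ≤ 0.3977) | 1.4302 | 1.2097 | +0.725, +0.162 | **[0.651, 0.733]** |
| **whole box** | (hull of the slabs) | | | | | **[0.651, 0.7522]** |

Sources: three-band model [HybertsenSchluterChristensen1989, Eq. (1)]; face point of the bilinear contour [AndersenEtAl1995, §6]; [folklore] algebra.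
-/

noncomputable section

namespace Summit.Ventures.CertifiedManyBodySolver.Downfold.Emery

open Real Set

/-- **Slab 1 (t_pd ∈ [1.25, 1.323] eV) of `emeryBoxBi2201M61MoreePPSrc (EmeryBoxesKSlicesN)`, ν = 103/250: the antinodal Fermi-surface Cu-d weight of every member lies in `[0.6622, 0.7522]`**
(normalised-slab v2 corner rule; brackets `faceDirPt_Bi2201M61_nH1176_s1_lo_br` / `_hi_br`). [folklore] -/
theorem bi2201M61Box_dWeightFaceDir_nH1176_s1 {Δ a b c : ℝ} (hΔ : Δ ∈ Icc ((44 : ℝ) / 25) ((59 : ℝ) / 25)) (ha : a ∈ Icc ((5 : ℝ) / 4) ((397 : ℝ) / 300)) (hb : b ∈ Icc ((31 : ℝ) / 50) ((37 : ℝ) / 50)) (hc : c ∈ Icc ((7 : ℝ) / 50) ((17 : ℝ) / 100)) :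
    dWeightFace Δ a b c (fermiEnergyOf Δ a b c ((103 : ℝ) / 250)) ∈ Icc ((3311 : ℝ) / 5000) ((3761 : ℝ) / 5000) := by
  have ha0 : 0 < a := lt_of_lt_of_le (by norm_num) ha.1
  rw [dWeightFace_fermiEnergyOf_eq_ratios ha0]
  have hΔn : Δ / a ∈ Icc ((528 : ℝ) / 397) ((236 : ℝ) / 125) := by
    constructor
    · rw [le_div_iff₀ ha0]; linarith [hΔ.1, ha.2]
    · rw [div_le_iff₀ ha0]; linarith [hΔ.2, ha.1]
  have hbn : b / a ∈ Icc ((186 : ℝ) / 397) ((74 : ℝ) / 125) := by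
    constructor
    · rw [le_div_iff₀ ha0]; linarith [hb.1, ha.2]
    · rw [div_le_iff₀ ha0]; linarith [hb.2, ha.1]
  have hcn : c / a ∈ Icc ((42 : ℝ) / 397) ((17 : ℝ) / 125) := by
    constructor
    · rw [le_div_iff₀ ha0]; linarith [hc.1, ha.2]
    · rw [div_le_iff₀ ha0]; linarith [hc.2, ha.1]
  have hVH : ∀ Δ' b' c' : ℝ, Δ' ∈ Icc ((528 : ℝ) / 397) ((236 : ℝ) / 125) → b' ∈ Icc ((186 : ℝ) / 397) ((74 : ℝ) / 125) → c' ∈ Icc ((42 : ℝ) / 397) ((17 : ℝ) / 125) →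
      1 - 2 * ((103 : ℝ) / 250) ≤ xVH Δ' 1 b' c' := by
    intro Δ' b' c' hΔ' hb' hc'
    have h := xVH_window_of_vhBoxCheck (Δ₁ := ((528 : ℚ) / 397)) (Δ₂ := ((236 : ℚ) / 125)) (a₁ := (1 : ℚ)) (a₂ := (1 : ℚ)) (b₁ := ((186 : ℚ) / 397)) (b₂ := ((74 : ℚ) / 125))
      (c₁ := ((42 : ℚ) / 397)) (c₂ := ((17 : ℚ) / 125)) (v₁ := ((5623 : ℚ) / 5000)) (v₂ := ((13071 : ℚ) / 10000)) (e := ((3179 : ℚ) / 2500)) (E := ((11543 : ℚ) / 10000))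
      (q₁ := ((13 : ℚ) / 25)) (q₂ := ((8729 : ℚ) / 10000)) (by decide +kernel)
      (Δ := Δ') (tpd := 1) (tpp := b') (c := c') (by simpa using hΔ') (by simp) (by simpa using hb') (by simpa using hc')
    obtain ⟨-, -, -, -, -, hwin⟩ := h
    push_cast at hwin
    have ht := vhFrac_13_25
    have hmono := vhFrac_anti (show (13 / 25 : ℝ) ≤ ((13 : ℝ) / 25) by norm_num)
    have hnu : ((57603 : ℝ) / 147456) ≤ ((103 : ℝ) / 250) := by norm_num
    linarith [hwin.1, ht.2]
  have hEh := (fermiEnergyOf_of_pointBracketCheck faceDirPt_Bi2201M61_nH1176_s1_lo_br (by norm_num) (by norm_num) (by norm_num) (ν := (103/250 : ℝ))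
    (by push_cast; exact ⟨le_rfl, le_rfl⟩)).2
  have hEv := (fermiEnergyOf_of_pointBracketCheck faceDirPt_Bi2201M61_nH1176_s1_hi_br (by norm_num) (by norm_num) (by norm_num) (ν := (103/250 : ℝ))
    (by push_cast; exact ⟨le_rfl, le_rfl⟩)).2
  push_cast at hEh hEv
  refine dWeightFace_fermiEnergyOf_mem_Icc_of_mem_box3_dir_num (Eh := ((1739 : ℝ) / 1250)) (Ev := ((2877 : ℝ) / 2500)) (Elow := ((713 : ℝ) / 625)) (κ₀ := 1 / 10) (κ := 1 / 10)
    (by norm_num) one_pos (by norm_num) (by norm_num) (by norm_num) hΔn hbn hcn (by norm_num) (by norm_num) hVH hEh.2 (by norm_num)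
    (by norm_num [faceU, fsD, fsN, cA]) (by norm_num [faceU, fsD, fsN, cA]) (by norm_num [faceU, fsD, fsN, cA]) (by norm_num [faceU, fsD, fsN, cA])
    hEv.1 (by norm_num) (by norm_num) (by norm_num [faceG]) (by norm_num) (by norm_num) (by norm_num) le_rfl (by norm_num [dWeightAxisCF])
    (by norm_num) (by norm_num) ?_ (by norm_num [dWeightFaceLoDec, faceRUp, faceN]) (by norm_num [dWeightFaceCF, faceN, faceR, fsN])
  intro D B C e hD hB hC he hG
  exact faceDir_nonneg_of_mem_region ⟨le_trans (by norm_num) hD.1, le_trans hD.2 (by norm_num)⟩ ⟨le_trans (by norm_num) he.1, le_trans he.2 (by norm_num)⟩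
    ⟨le_trans (by norm_num) hB.1, le_trans hB.2 (by norm_num)⟩ ⟨le_trans (by norm_num) hC.1, le_trans hC.2 (by norm_num)⟩ hG

/-- **Slab 2 (t_pd ∈ [1.323, 1.397] eV) of `emeryBoxBi2201M61MoreePPSrc (EmeryBoxesKSlicesN)`, ν = 103/250: the antinodal Fermi-surface Cu-d weight of every member lies in `[0.6563, 0.7421]`**
(normalised-slab v2 corner rule; brackets `faceDirPt_Bi2201M61_nH1176_s2_lo_br` / `_hi_br`). [folklore] -/
theorem bi2201M61Box_dWeightFaceDir_nH1176_s2 {Δ a b c : ℝ} (hΔ : Δ ∈ Icc ((44 : ℝ) / 25) ((59 : ℝ) / 25)) (ha : a ∈ Icc ((397 : ℝ) / 300) ((419 : ℝ) / 300)) (hb : b ∈ Icc ((31 : ℝ) / 50) ((37 : ℝ) / 50)) (hc : c ∈ Icc ((7 : ℝ) / 50) ((17 : ℝ) / 100)) :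
    dWeightFace Δ a b c (fermiEnergyOf Δ a b c ((103 : ℝ) / 250)) ∈ Icc ((6563 : ℝ) / 10000) ((7421 : ℝ) / 10000) := by
  have ha0 : 0 < a := lt_of_lt_of_le (by norm_num) ha.1
  rw [dWeightFace_fermiEnergyOf_eq_ratios ha0]
  have hΔn : Δ / a ∈ Icc ((528 : ℝ) / 419) ((708 : ℝ) / 397) := by
    constructor
    · rw [le_div_iff₀ ha0]; linarith [hΔ.1, ha.2]
    · rw [div_le_iff₀ ha0]; linarith [hΔ.2, ha.1]
  have hbn : b / a ∈ Icc ((186 : ℝ) / 419) ((222 : ℝ) / 397) := by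
    constructor
    · rw [le_div_iff₀ ha0]; linarith [hb.1, ha.2]
    · rw [div_le_iff₀ ha0]; linarith [hb.2, ha.1]
  have hcn : c / a ∈ Icc ((42 : ℝ) / 419) ((51 : ℝ) / 397) := by
    constructor
    · rw [le_div_iff₀ ha0]; linarith [hc.1, ha.2]
    · rw [div_le_iff₀ ha0]; linarith [hc.2, ha.1]
  have hVH : ∀ Δ' b' c' : ℝ, Δ' ∈ Icc ((528 : ℝ) / 419) ((708 : ℝ) / 397) → b' ∈ Icc ((186 : ℝ) / 419) ((222 : ℝ) / 397) → c' ∈ Icc ((42 : ℝ) / 419) ((51 : ℝ) / 397) →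
      1 - 2 * ((103 : ℝ) / 250) ≤ xVH Δ' 1 b' c' := by
    intro Δ' b' c' hΔ' hb' hc'
    have h := xVH_window_of_vhBoxCheck (Δ₁ := ((528 : ℚ) / 419)) (Δ₂ := ((708 : ℚ) / 397)) (a₁ := (1 : ℚ)) (a₂ := (1 : ℚ)) (b₁ := ((186 : ℚ) / 419)) (b₂ := ((222 : ℚ) / 397))
      (c₁ := ((42 : ℚ) / 419)) (c₂ := ((51 : ℚ) / 397)) (v₁ := ((11577 : ℚ) / 10000)) (v₂ := ((13351 : ℚ) / 10000)) (e := ((813 : ℚ) / 625)) (E := ((11867 : ℚ) / 10000))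
      (q₁ := ((2503 : ℚ) / 5000)) (q₂ := ((1651 : ℚ) / 2000)) (by decide +kernel)
      (Δ := Δ') (tpd := 1) (tpp := b') (c := c') (by simpa using hΔ') (by simp) (by simpa using hb') (by simpa using hc')
    obtain ⟨-, -, -, -, -, hwin⟩ := h
    push_cast at hwin
    have ht := vhFrac_1_2
    have hmono := vhFrac_anti (show (1 / 2 : ℝ) ≤ ((2503 : ℝ) / 5000) by norm_num)
    have hnu : ((57961 : ℝ) / 147456) ≤ ((103 : ℝ) / 250) := by norm_num
    linarith [hwin.1, ht.2]
  have hEh := (fermiEnergyOf_of_pointBracketCheck faceDirPt_Bi2201M61_nH1176_s2_lo_br (by norm_num) (by norm_num) (by norm_num) (ν := (103/250 : ℝ))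
    (by push_cast; exact ⟨le_rfl, le_rfl⟩)).2
  have hEv := (fermiEnergyOf_of_pointBracketCheck faceDirPt_Bi2201M61_nH1176_s2_hi_br (by norm_num) (by norm_num) (by norm_num) (ν := (103/250 : ℝ))
    (by push_cast; exact ⟨le_rfl, le_rfl⟩)).2
  push_cast at hEh hEv
  refine dWeightFace_fermiEnergyOf_mem_Icc_of_mem_box3_dir_num (Eh := ((14117 : ℝ) / 10000)) (Ev := ((591 : ℝ) / 500)) (Elow := ((293 : ℝ) / 250)) (κ₀ := 1 / 10) (κ := 1 / 10)
    (by norm_num) one_pos (by norm_num) (by norm_num) (by norm_num) hΔn hbn hcn (by norm_num) (by norm_num) hVH hEh.2 (by norm_num)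
    (by norm_num [faceU, fsD, fsN, cA]) (by norm_num [faceU, fsD, fsN, cA]) (by norm_num [faceU, fsD, fsN, cA]) (by norm_num [faceU, fsD, fsN, cA])
    hEv.1 (by norm_num) (by norm_num) (by norm_num [faceG]) (by norm_num) (by norm_num) (by norm_num) le_rfl (by norm_num [dWeightAxisCF])
    (by norm_num) (by norm_num) ?_ (by norm_num [dWeightFaceLoDec, faceRUp, faceN]) (by norm_num [dWeightFaceCF, faceN, faceR, fsN])
  intro D B C e hD hB hC he hG
  exact faceDir_nonneg_of_mem_region ⟨le_trans (by norm_num) hD.1, le_trans hD.2 (by norm_num)⟩ ⟨le_trans (by norm_num) he.1, le_trans he.2 (by norm_num)⟩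
    ⟨le_trans (by norm_num) hB.1, le_trans hB.2 (by norm_num)⟩ ⟨le_trans (by norm_num) hC.1, le_trans hC.2 (by norm_num)⟩ hG

/-- **Slab 3 (t_pd ∈ [1.397, 1.47] eV) of `emeryBoxBi2201M61MoreePPSrc (EmeryBoxesKSlicesN)`, ν = 103/250: the antinodal Fermi-surface Cu-d weight of every member lies in `[0.651, 0.733]`**
(normalised-slab v2 corner rule; brackets `faceDirPt_Bi2201M61_nH1176_s3_lo_br` / `_hi_br`). [folklore] -/
theorem bi2201M61Box_dWeightFaceDir_nH1176_s3 {Δ a b c : ℝ} (hΔ : Δ ∈ Icc ((44 : ℝ) / 25) ((59 : ℝ) / 25)) (ha : a ∈ Icc ((419 : ℝ) / 300) ((147 : ℝ) / 100)) (hb : b ∈ Icc ((31 : ℝ) / 50) ((37 : ℝ) / 50)) (hc : c ∈ Icc ((7 : ℝ) / 50) ((17 : ℝ) / 100)) :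
    dWeightFace Δ a b c (fermiEnergyOf Δ a b c ((103 : ℝ) / 250)) ∈ Icc ((651 : ℝ) / 1000) ((733 : ℝ) / 1000) := by
  have ha0 : 0 < a := lt_of_lt_of_le (by norm_num) ha.1
  rw [dWeightFace_fermiEnergyOf_eq_ratios ha0]
  have hΔn : Δ / a ∈ Icc ((176 : ℝ) / 147) ((708 : ℝ) / 419) := by
    constructor
    · rw [le_div_iff₀ ha0]; linarith [hΔ.1, ha.2]
    · rw [div_le_iff₀ ha0]; linarith [hΔ.2, ha.1]
  have hbn : b / a ∈ Icc ((62 : ℝ) / 147) ((222 : ℝ) / 419) := by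
    constructor
    · rw [le_div_iff₀ ha0]; linarith [hb.1, ha.2]
    · rw [div_le_iff₀ ha0]; linarith [hb.2, ha.1]
  have hcn : c / a ∈ Icc ((2 : ℝ) / 21) ((51 : ℝ) / 419) := by
    constructor
    · rw [le_div_iff₀ ha0]; linarith [hc.1, ha.2]
    · rw [div_le_iff₀ ha0]; linarith [hc.2, ha.1]
  have hVH : ∀ Δ' b' c' : ℝ, Δ' ∈ Icc ((176 : ℝ) / 147) ((708 : ℝ) / 419) → b' ∈ Icc ((62 : ℝ) / 147) ((222 : ℝ) / 419) → c' ∈ Icc ((2 : ℝ) / 21) ((51 : ℝ) / 419) →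
      1 - 2 * ((103 : ℝ) / 250) ≤ xVH Δ' 1 b' c' := by
    intro Δ' b' c' hΔ' hb' hc'
    have h := xVH_window_of_vhBoxCheck (Δ₁ := ((176 : ℚ) / 147)) (Δ₂ := ((708 : ℚ) / 419)) (a₁ := (1 : ℚ)) (a₂ := (1 : ℚ)) (b₁ := ((62 : ℚ) / 147)) (b₂ := ((222 : ℚ) / 419))
      (c₁ := ((2 : ℚ) / 21)) (c₂ := ((51 : ℚ) / 419)) (v₁ := ((5943 : ℚ) / 5000)) (v₂ := ((1361 : ℚ) / 1000)) (e := ((13279 : ℚ) / 10000)) (E := ((1521 : ℚ) / 1250))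
      (q₁ := ((4823 : ℚ) / 10000)) (q₂ := ((489 : ℚ) / 625)) (by decide +kernel)
      (Δ := Δ') (tpd := 1) (tpp := b') (c := c') (by simpa using hΔ') (by simp) (by simpa using hb') (by simpa using hc')
    obtain ⟨-, -, -, -, -, hwin⟩ := h
    push_cast at hwin
    have ht := vhFrac_93_200
    have hmono := vhFrac_anti (show (93 / 200 : ℝ) ≤ ((4823 : ℝ) / 10000) by norm_num)
    have hnu : ((58647 : ℝ) / 147456) ≤ ((103 : ℝ) / 250) := by norm_num
    linarith [hwin.1, ht.2]
  have hEh := (fermiEnergyOf_of_pointBracketCheck faceDirPt_Bi2201M61_nH1176_s3_lo_br (by norm_num) (by norm_num) (by norm_num) (ν := (103/250 : ℝ))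
    (by push_cast; exact ⟨le_rfl, le_rfl⟩)).2
  have hEv := (fermiEnergyOf_of_pointBracketCheck faceDirPt_Bi2201M61_nH1176_s3_hi_br (by norm_num) (by norm_num) (by norm_num) (ν := (103/250 : ℝ))
    (by push_cast; exact ⟨le_rfl, le_rfl⟩)).2
  push_cast at hEh hEv
  refine dWeightFace_fermiEnergyOf_mem_Icc_of_mem_box3_dir_num (Eh := ((7151 : ℝ) / 5000)) (Ev := ((12097 : ℝ) / 10000)) (Elow := ((11997 : ℝ) / 10000)) (κ₀ := 1 / 10) (κ := 1 / 10)
    (by norm_num) one_pos (by norm_num) (by norm_num) (by norm_num) hΔn hbn hcn (by norm_num) (by norm_num) hVH hEh.2 (by norm_num)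
    (by norm_num [faceU, fsD, fsN, cA]) (by norm_num [faceU, fsD, fsN, cA]) (by norm_num [faceU, fsD, fsN, cA]) (by norm_num [faceU, fsD, fsN, cA])
    hEv.1 (by norm_num) (by norm_num) (by norm_num [faceG]) (by norm_num) (by norm_num) (by norm_num) le_rfl (by norm_num [dWeightAxisCF])
    (by norm_num) (by norm_num) ?_ (by norm_num [dWeightFaceLoDec, faceRUp, faceN]) (by norm_num [dWeightFaceCF, faceN, faceR, fsN])
  intro D B C e hD hB hC he hG
  exact faceDir_nonneg_of_mem_region ⟨le_trans (by norm_num) hD.1, le_trans hD.2 (by norm_num)⟩ ⟨le_trans (by norm_num) he.1, le_trans he.2 (by norm_num)⟩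
    ⟨le_trans (by norm_num) hB.1, le_trans hB.2 (by norm_num)⟩ ⟨le_trans (by norm_num) hC.1, le_trans hC.2 (by norm_num)⟩ hG

/-- **`emeryBoxBi2201M61MoreePPSrc (EmeryBoxesKSlicesN)`, ν = 103/250: for EVERY member θ the Cu-d weight of the antinodal Fermi-surface state lies in `[0.651, 0.7522]`** (hull of the 3 t_pd slab windows; regime-free rule v2). [folklore] -/
theorem bi2201M61Box_dWeightFaceDir_nH1176 {Δ a b c : ℝ} (hΔ : Δ ∈ Icc ((44 : ℝ) / 25) ((59 : ℝ) / 25)) (ha : a ∈ Icc ((5 : ℝ) / 4) ((147 : ℝ) / 100)) (hb : b ∈ Icc ((31 : ℝ) / 50) ((37 : ℝ) / 50)) (hc : c ∈ Icc ((7 : ℝ) / 50) ((17 : ℝ) / 100)) :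
    dWeightFace Δ a b c (fermiEnergyOf Δ a b c ((103 : ℝ) / 250)) ∈ Icc ((651 : ℝ) / 1000) ((3761 : ℝ) / 5000) := by
  rcases le_or_gt a ((397 : ℝ) / 300) with h1 | h1
  · have h := bi2201M61Box_dWeightFaceDir_nH1176_s1 hΔ ⟨ha.1, h1⟩ hb hc
    exact ⟨le_trans (by norm_num) h.1, le_trans h.2 (by norm_num)⟩
  · rcases le_or_gt a ((419 : ℝ) / 300) with h2 | h2
    · have h := bi2201M61Box_dWeightFaceDir_nH1176_s2 hΔ ⟨h1.le, h2⟩ hb hc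
      exact ⟨le_trans (by norm_num) h.1, le_trans h.2 (by norm_num)⟩
    · have h := bi2201M61Box_dWeightFaceDir_nH1176_s3 hΔ ⟨h2.le, ha.2⟩ hb hc
      exact ⟨le_trans (by norm_num) h.1, le_trans h.2 (by norm_num)⟩

end Summit.Ventures.CertifiedManyBodySolver.Downfold.Emery
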